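/-
Copyright (c) 2026. All rights reserved.
Released under Apache 2.0 license as described in the file LICENSE.
Authors: abc-iut cell — seat abc-iut-w4-d104 (wave 4, D-0067; node AbsTopIII:Prop2.6 / Prop 2.5 (e)).
Proof-only; no new definitions.
-/
import Literature.AnabelianGeometry.AbsoluteAnabelian.HolomorphicCoresLocalAddCompat
import Literature.AnabelianGeometry.AbsoluteAnabelian.ParallelogramsPlanarRecovered
import HarnessLib

/-!
# [AbsTopIII] Prop 2.5 (e) / Prop 2.6: the bridge, unconditionally

The files `ParallelogramsLocalAddProofs`, `ParallelogramsLocalAddExists`, `HolomorphicCoresLocalAddCompat`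
(seat abc-iut-w4-d104) prove that the local additive structure `Parallelograms.LocalAdd 𝒬 p a b c` of
[AbsTopIII] Prop. 2.5 (e) is the parallelogram law near `p`, and that compatibility of a local map with
it is local additivity, GRANTED the Prop. 2.5 (c) reconstruction `parallelograms 𝒬 = 𝒫(U)` as a
hypothesis `H`.  That reconstruction is now a theorem of the tree
(`Parallelograms.parallelograms_eq_of_subset`, seat abc-iut-L6-t15, `ParallelogramsPlanarRecovered`),
so here the hypothesis is discharged: the statements hold for every open `U ⊆ ℂ` and every collection
`𝒮(U) ⊆ 𝒬 ⊆ 𝒫(U)` — in particular for the printed input data `(U, 𝒮(U))` and `(U, ℛ(U))`.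
S. Mochizuki, *Topics in absolute anabelian geometry III*, Prop. 2.5 (e) p. 57, Prop. 2.6 (a) p. 57
(bib key `MochizukiAbsTopIII2015`).  Refereed pre-IUT material; nothing here bears on the disputed
[IUTchIII] Cor. 3.12.
-/

namespace Literature.AnabelianGeometry.AbsoluteAnabelian

open _root_.Complex _root_.Set _root_.Topology _root_.Filter

noncomputable section

section Unconditional

variable {U : Set ℂ}

/-- **[AbsTopIII] Prop 2.5 (e) IS the parallelogram law near `p`** (unconditional form): for `U ⊆ ℂ`
open, any `𝒮(U) ⊆ 𝒬 ⊆ 𝒫(U)` and `p ∈ U` there is `ε > 0` such that for `a, b ∈ U` within `ε` of `p`,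
`a, b ≠ p`, and `c ∈ U`: `LocalAdd 𝒬 p a b c ↔ (a − p, b − p independent ∧ c = a + b − p)`.
[cite: MochizukiAbsTopIII2015, Proposition 2.5 (e) p.57] -/
theorem Parallelograms.exists_nhds_localAdd_iff' (hU : IsOpen U) {𝒬 : Set (Set U)}
    (h𝒬 : ∀ Q ∈ 𝒬, Subtype.val '' Q ∈ parallelogramsIn U)
    (h𝒮 : ∀ Q : Set U, Subtype.val '' Q ∈ squaresIn U → Q ∈ 𝒬) (p : U) :
    ∃ ε > 0, ∀ a b c : U, ‖(a : ℂ) - p‖ < ε → ‖(b : ℂ) - p‖ < ε → a ≠ p → b ≠ p →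
      (Parallelograms.LocalAdd 𝒬 p a b c ↔
        LinearIndependent ℝ ![(a : ℂ) - p, (b : ℂ) - p] ∧ (c : ℂ) = a + b - p) :=
  Parallelograms.exists_nhds_localAdd_iff hU h𝒬 h𝒮
    (Parallelograms.parallelograms_eq_of_subset hU h𝒬 h𝒮) p

/-- **Prop 2.5 (e) for the printed input data `(U, 𝒮(U))`**: `a +_p b = a + b − p` near `p` (general
position), computed from the squares alone. [cite: MochizukiAbsTopIII2015, Proposition 2.5 (e) p.57] -/
theorem Parallelograms.exists_nhds_localAdd_squares_iff (hU : IsOpen U) (p : U) :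
    ∃ ε > 0, ∀ a b c : U, ‖(a : ℂ) - p‖ < ε → ‖(b : ℂ) - p‖ < ε → a ≠ p → b ≠ p →
      (Parallelograms.LocalAdd {Q : Set U | Subtype.val '' Q ∈ squaresIn U} p a b c ↔
        LinearIndependent ℝ ![(a : ℂ) - p, (b : ℂ) - p] ∧ (c : ℂ) = a + b - p) :=
  Parallelograms.exists_nhds_localAdd_iff' hU (fun _ hQ => squaresIn_subset_parallelogramsIn U hQ)
    (fun _ h => h) p

/-- **[AbsTopIII] Prop 2.6 (a), first condition, unconditionally**: a self-map of `ℂ` fixing `p`,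
continuous on a ball `B(p, r) ⊆ U`, that carries the Prop 2.5 (e) sums `a +_p b = c` (computed from
`(U, 𝒬(U))`, any `𝒮(U) ⊆ 𝒬 ⊆ 𝒫(U)`) to `f a +_p f b = f c` is locally additive at `p`
(`LocGerm.IsLocallyAdditiveAt`), the condition `LocGerm.IsAddCompat` of the germ group `germAut p` asks
of a representative. [cite: MochizukiAbsTopIII2015, Proposition 2.6 (a) p.57] -/
theorem LocGerm.isLocallyAdditiveAt_of_localAdd_compat' (hU : IsOpen U) {𝒬 : Set (Set U)}
    (h𝒬 : ∀ Q ∈ 𝒬, Subtype.val '' Q ∈ parallelogramsIn U)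
    (h𝒮 : ∀ Q : Set U, Subtype.val '' Q ∈ squaresIn U → Q ∈ 𝒬)
    (p : U) {f : ℂ → ℂ} (hfp : f p = p) {r : ℝ} (hr : 0 < r)
    (hball : Metric.ball (p : ℂ) r ⊆ U) (hfc : ContinuousOn f (Metric.ball (p : ℂ) r))
    (hcompat : ∀ a b c : U, ‖(a : ℂ) - p‖ < r → ‖(b : ℂ) - p‖ < r → ‖(c : ℂ) - p‖ < r →
      Parallelograms.LocalAdd 𝒬 p a b c →
      ∀ (ha' : f a ∈ U) (hb' : f b ∈ U) (hc' : f c ∈ U),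
        Parallelograms.LocalAdd 𝒬 p ⟨f a, ha'⟩ ⟨f b, hb'⟩ ⟨f c, hc'⟩) :
    ∃ r' > 0, LocGerm.IsLocallyAdditiveAt (p : ℂ) f r' :=
  LocGerm.isLocallyAdditiveAt_of_localAdd_compat hU h𝒬 h𝒮
    (Parallelograms.parallelograms_eq_of_subset hU h𝒬 h𝒮) p hfp hr hball hfc hcompat

/-- **Affine germs are compatible with `+_p`**, unconditionally (any `𝒮(U) ⊆ 𝒬 ⊆ 𝒫(U)`).
[cite: MochizukiAbsTopIII2015, Proposition 2.6 (a) p.57] -/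
theorem Parallelograms.localAdd_map_affine' (hU : IsOpen U) {𝒬 : Set (Set U)}
    (h𝒬 : ∀ Q ∈ 𝒬, Subtype.val '' Q ∈ parallelogramsIn U)
    (h𝒮 : ∀ Q : Set U, Subtype.val '' Q ∈ squaresIn U → Q ∈ 𝒬)
    (p : U) {L : ℂ →L[ℝ] ℂ} (hL : Function.Injective L) :
    ∃ δ > 0, ∀ a b c : U, ‖(a : ℂ) - p‖ < δ → ‖(b : ℂ) - p‖ < δ →
      Parallelograms.LocalAdd 𝒬 p a b c →
      ∀ (ha' : (p : ℂ) + L (a - p) ∈ U) (hb' : (p : ℂ) + L (b - p) ∈ U)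
        (hc' : (p : ℂ) + L (c - p) ∈ U),
        Parallelograms.LocalAdd 𝒬 p ⟨_, ha'⟩ ⟨_, hb'⟩ ⟨_, hc'⟩ :=
  Parallelograms.localAdd_map_affine hU h𝒬 h𝒮 (Parallelograms.parallelograms_eq_of_subset hU h𝒬 h𝒮)
    p hL

/-- **Germ form**: under the hypotheses of `LocGerm.isLocallyAdditiveAt_of_localAdd_compat'`, the local
germ of `f` at `p` satisfies the first defining condition `LocGerm.IsAddCompat` of the germ group
`𝒜_p = germAut p` ([AbsTopIII] Prop 2.6 (a)) — read off the `(U, 𝒬(U))`-data alone.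
[cite: MochizukiAbsTopIII2015, Proposition 2.6 (a) p.57] -/
theorem LocGerm.isAddCompat_ofFun_of_localAdd_compat (hU : IsOpen U) {𝒬 : Set (Set U)}
    (h𝒬 : ∀ Q ∈ 𝒬, Subtype.val '' Q ∈ parallelogramsIn U)
    (h𝒮 : ∀ Q : Set U, Subtype.val '' Q ∈ squaresIn U → Q ∈ 𝒬)
    (p : U) {f : ℂ → ℂ} (hfp : f p = p) {r : ℝ} (hr : 0 < r)
    (hball : Metric.ball (p : ℂ) r ⊆ U) (hfc : ContinuousOn f (Metric.ball (p : ℂ) r))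
    (hcompat : ∀ a b c : U, ‖(a : ℂ) - p‖ < r → ‖(b : ℂ) - p‖ < r → ‖(c : ℂ) - p‖ < r →
      Parallelograms.LocalAdd 𝒬 p a b c →
      ∀ (ha' : f a ∈ U) (hb' : f b ∈ U) (hc' : f c ∈ U),
        Parallelograms.LocalAdd 𝒬 p ⟨f a, ha'⟩ ⟨f b, hb'⟩ ⟨f c, hc'⟩) :
    (LocGerm.ofFun f (LocGerm.tendsto_of_continuousAt
      (hfc.continuousAt (Metric.isOpen_ball.mem_nhds (Metric.mem_ball_self hr))) hfp)).IsAddCompat := by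
  obtain ⟨r', hr', h⟩ :=
    LocGerm.isLocallyAdditiveAt_of_localAdd_compat' hU h𝒬 h𝒮 p hfp hr hball hfc hcompat
  exact ⟨f, _, rfl, r', hr', h⟩

end Unconditional

end

end Literature.AnabelianGeometry.AbsoluteAnabelian
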